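import Literature.MathematicalPhysics.QuantumFieldTheory.King1986.EndpointCoercivity
import Mathlib.Analysis.SpecialFunctions.Trigonometric.Sinc
import HarnessLib

/-!
# BalabanUVNodes ∕ N15 — THE KING-MODEL RUNG (PART Ε-s): KING's EFFECTIVE-LAPLACIAN SYMBOL (4.5) IS CONTINUOUS ON THE CLOSED ZONE — the alias weight
# `|u(p′)|² = Π_μ S₁(p′_μ)∕S_η(p′_μ)` is `Π_μ (sinc(p′_μ∕2)∕sinc(p′_μ∕2N))²` (removable singularity included), the shifted weights and symbols are continuous where
# they are used, hence `p′ ↦ Δ^{(K)}(p′) = DeltaEff a N m² p′` and `log Δ^{(K)}` are continuous at every `p′ ∈ [−π,π]^{d+1}`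
# (Track A, DAG node N15 = NE2; FAN-OUT v1.1 §N15 s3 «KING-MODEL RUNG»; the input part Ε-r's Riemann engine needs; count-neutral)

HONEST FRAMING.  Count-neutral (cell `pub-ymgap`, seat `pub-ymgap-dag-n15-e` g40; `--supports stmt-QuantumFields-27366 --as helper` = K3⁸).
TEMPLATE LITERATURE: C. King, Commun. Math. Phys. **102** (1986) 649–677 [King1986], (4.3)–(4.5) p.670 (`u_k^η(p) = Π_μ (e^{ip_μ}−1)∕(η⁻¹(e^{iηp_μ}−1))`, `Δ^{(k)}(p′) =
(a_k⁻¹ + Σ_l |u(p′+l)|²Δ^η(p′+l)⁻¹)⁻¹`); [Balaban1983RegularityDecay] (2.45) p.584.  The cell's real forms (`B4Strip.uFactorr`, `Ur`, `DeltaXir`, `shiftr`; `King1986.composedInvResc`,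
`DeltaEff`) fill the removable singularity of `S₁(x)∕S_η(x)` at `x = 0` by hand and divide by zero (Lean's `x∕0 = 0`) at `x ∈ 2πNℤ∖{0}`, so they are NOT globally continuous;
the dual-torus Riemann engine (part Ε-r) needs continuity at every point of the CLOSED zone only.  THIS FILE: §1 ★ **`uFactorr_zero_eq_sinc_ratio_sq`** — `uFactorr N 0 x =
(sinc(x∕2)∕sinc(x∕2N))²` for ALL real `x` (`N ≥ 1`; Mathlib's `Real.sinc`; `B4Strip.S1r_eq`∕`Sxir_eq`), `sinc_ne_zero_of_abs_lt_pi`, ★ `continuousAt_uFactorr_zero` (`|x| < 2πN`), ★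
`continuousAt_uFactorr_shift` (`1 ≤ k ≤ N−1`, `|x| ≤ π`: the shifted denominator `S_η(x+2πk)` does not vanish, `Real.cos_eq_one_iff_of_lt_of_lt`); §2 ★ `continuousAt_Ur` (all aliases
`l`, `|p′_μ| ≤ π`), `continuous_DeltaXir_shiftr`, `DeltaXir_shiftr_pos`, `composedInvResc_pos_of_pos`, ★★ **`continuousAt_composedInvResc`**, ★★★ **`continuousAt_DeltaEff`** (`a > 0`,
`m² > 0`, `N ≥ 1`, every `p′ ∈ [−π,π]^{d+1}`), ★★ **`continuousAt_log_DeltaEff`**, `continuousOn_log_DeltaEff` (on the compact zone `Icc (−π) π`).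

PRIOR TREE ART (used, not restated): `B4Strip` (`S1r`, `Sxir`, `S1r_eq`, `Sxir_eq`, `uFactorr`, `uFactorr_eq_div` (King1986), `Ur`, `Ur_nonneg`, `DeltaXir`, `DeltaXir_nonneg`, `shiftr`),
`King1986.CompositionLaw`∕`CompositionRate`∕`EndpointCoercivity` (`composedInvResc`, `DeltaEff`, `DeltaEff_le`, `DeltaEff_pos'`), part Ϝ-j `…TwoPointFiniteKVolumeLimit` (the
rescaled twin `uFactorr_zero_eq_sinc_sq : uFactorr N 0 (Nθ) = (sinc(Nθ∕2)∕sinc(θ∕2))²` and `continuousAt_qqSymbol`, `|θ_μ| < 2π`, for the `l = 0` weight only), Mathlib (`Real.sinc`, `Real.continuous_sinc`, `Real.sin_eq_zero_iff_of_lt_of_lt`,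
`Real.cos_eq_one_iff_of_lt_of_lt`).  NOT Bałaban's covariant objects; NOT a node discharge (N15 is booked through n15-a's knit, untouched); nothing continuum-YM ∕ `ℝ⁴` ∕ OS ∕ Clay.
0 `sorry`, 0 `def`.

HONEST SCOPE.  One-variable real analysis and finite sums∕products; `N ≥ 1` fine sites per block side, `a > 0`, `m² ≥ 0` (`> 0` where inverted), any dimension.  Locators: [King1986]
(4.3)–(4.5) p.670; [Balaban1983RegularityDecay] (2.45) p.584.
-/

noncomputable section

open scoped BigOperators Topology
open Finset Filter

namespace Summit.QuantumFields.YangMills.BalabanUVNodes.N15KingModelRung.TorusSpectral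

open Literature.MathematicalPhysics.QuantumFieldTheory.Balaban1983to89.B4Strip (S1r Sxir S1r_eq Sxir_eq uFactorr Ur Ur_nonneg DeltaXir DeltaXir_nonneg shiftr)
open Literature.MathematicalPhysics.QuantumFieldTheory.King1986 (composedInvResc DeltaEff DeltaEff_le DeltaEff_pos' uFactorr_eq_div)

/-! ## §1 One coordinate: the alias factor through `sinc` -/

section OneDim

/-- `sin y = sinc(y)·y` for every real `y`. [folklore] -/
theorem sin_eq_sinc_mul (y : ℝ) : Real.sin y = Real.sinc y * y := by
  rcases eq_or_ne y 0 with rfl | hy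
  · simp
  · rw [Real.sinc_of_ne_zero hy, div_mul_cancel₀ _ hy]

/-- `S₁(x) = 2 − 2cos x = sinc(x∕2)²·x²`. [cite: Balaban1983RegularityDecay, (2.45) p.584] -/
theorem S1r_eq_sinc_sq (x : ℝ) : S1r x = Real.sinc (x / 2) ^ 2 * x ^ 2 := by
  rw [S1r_eq, sin_eq_sinc_mul]
  ring

/-- `S_η(x) = N²(2 − 2cos(x∕N)) = sinc(x∕2N)²·x²` (`N ≠ 0`). [cite: Balaban1983RegularityDecay, (2.45) p.584] -/
theorem Sxir_eq_sinc_sq {N : ℕ} (hN : N ≠ 0) (x : ℝ) : Sxir N x = Real.sinc (x / (2 * N)) ^ 2 * x ^ 2 := by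
  have hN' : (N : ℝ) ≠ 0 := by exact_mod_cast hN
  rw [Sxir_eq, sin_eq_sinc_mul]
  field_simp
  ring

/-- ★ **THE ALIAS FACTOR THROUGH `sinc`, SINGULARITY INCLUDED**: `uFactorr N 0 x = (sinc(x∕2)∕sinc(x∕2N))²` for EVERY real `x` (`N ≠ 0`; at `x = 0` both sides are `1`, at the
zeros of the denominator both sides are `0` by Lean's `x∕0 = 0`). [cite: King1986, (4.3) p.670; Balaban1983RegularityDecay, (2.45) p.584] -/
theorem uFactorr_zero_eq_sinc_ratio_sq {N : ℕ} (hN : N ≠ 0) (x : ℝ) : uFactorr N 0 x = (Real.sinc (x / 2) / Real.sinc (x / (2 * N))) ^ 2 := by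
  rcases eq_or_ne x 0 with rfl | hx
  · simp [uFactorr, Real.sinc_zero]
  · rw [uFactorr_eq_div (Or.inr hx), Nat.cast_zero, mul_zero, add_zero, S1r_eq_sinc_sq, Sxir_eq_sinc_sq hN, div_pow,
      mul_div_mul_right _ _ (pow_ne_zero 2 hx)]

/-- `sinc y ≠ 0` for `|y| < π`. [folklore] -/
theorem sinc_ne_zero_of_abs_lt_pi {y : ℝ} (hy : |y| < Real.pi) : Real.sinc y ≠ 0 := by
  rcases eq_or_ne y 0 with rfl | hy0
  · rw [Real.sinc_zero]; exact one_ne_zero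
  · rw [Real.sinc_of_ne_zero hy0]
    refine div_ne_zero (fun h => hy0 ?_) hy0
    exact (Real.sin_eq_zero_iff_of_lt_of_lt (by linarith [(abs_lt.mp hy).1]) (abs_lt.mp hy).2).mp h

/-- ★ the unshifted alias factor is continuous at every `|x| < 2πN` (in particular on the closed zone `|x| ≤ π`). [cite: King1986, (4.3) p.670] -/
theorem continuousAt_uFactorr_zero {N : ℕ} (hN : 1 ≤ N) {x : ℝ} (hx : |x| < 2 * Real.pi * N) : ContinuousAt (uFactorr N 0) x := by
  have hN0 : N ≠ 0 := by omega
  have hNpos : (0 : ℝ) < N := by exact_mod_cast (show 0 < N by omega)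
  have hfun : uFactorr N 0 = fun y => (Real.sinc (y / 2) / Real.sinc (y / (2 * N))) ^ 2 := funext (uFactorr_zero_eq_sinc_ratio_sq hN0)
  rw [hfun]
  have hden : Real.sinc (x / (2 * N)) ≠ 0 := by
    refine sinc_ne_zero_of_abs_lt_pi ?_
    rw [abs_div, abs_of_pos (by positivity : (0 : ℝ) < 2 * N), div_lt_iff₀ (by positivity)]
    linarith
  exact (((Real.continuous_sinc.comp (continuous_id.div_const _)).continuousAt).div
    ((Real.continuous_sinc.comp (continuous_id.div_const _)).continuousAt) hden).pow 2

/-- the shifted fine symbol does not vanish on the zone: `S_η(x + 2πk) ≠ 0` for `1 ≤ k ≤ N − 1`, `|x| ≤ π`. [cite: King1986, p.671] -/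
theorem Sxir_shift_ne_zero {N k : ℕ} (hk1 : 1 ≤ k) (hkN : k + 1 ≤ N) {x : ℝ} (hx : |x| ≤ Real.pi) : Sxir N (x + 2 * Real.pi * k) ≠ 0 := by
  have hπ := Real.pi_pos
  have hNpos : (0 : ℝ) < N := by exact_mod_cast (show 0 < N by omega)
  have hk1' : (1 : ℝ) ≤ k := by exact_mod_cast hk1
  have hkN' : (k : ℝ) + 1 ≤ N := by exact_mod_cast hkN
  obtain ⟨hx1, hx2⟩ := abs_le.mp hx
  unfold Literature.MathematicalPhysics.QuantumFieldTheory.Balaban1983to89.B4Strip.Sxir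
  refine mul_ne_zero (by positivity) fun h => ?_
  have hcos : Real.cos ((x + 2 * Real.pi * k) / N) = 1 := by linarith
  have hlo : 0 < (x + 2 * Real.pi * k) / N := div_pos (by nlinarith) hNpos
  have hhi : (x + 2 * Real.pi * k) / N < 2 * Real.pi := by rw [div_lt_iff₀ hNpos]; nlinarith
  have := (Real.cos_eq_one_iff_of_lt_of_lt (by linarith) hhi).mp hcos
  linarith

/-- ★ the shifted alias factors are continuous on the closed zone: `ContinuousAt (uFactorr N k) x` for `1 ≤ k ≤ N − 1`, `|x| ≤ π`. [cite: King1986, (4.3) p.670] -/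
theorem continuousAt_uFactorr_shift {N k : ℕ} (hk1 : 1 ≤ k) (hkN : k + 1 ≤ N) {x : ℝ} (hx : |x| ≤ Real.pi) : ContinuousAt (uFactorr N k) x := by
  have hk0 : k ≠ 0 := by omega
  have hfun : uFactorr N k = fun y => S1r y / Sxir N (y + 2 * Real.pi * k) := funext fun y => uFactorr_eq_div (Or.inl hk0)
  rw [hfun]
  have h1 : Continuous fun y : ℝ => S1r y := by
    unfold Literature.MathematicalPhysics.QuantumFieldTheory.Balaban1983to89.B4Strip.S1r; fun_prop
  have h2 : Continuous fun y : ℝ => Sxir N (y + 2 * Real.pi * k) := by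
    unfold Literature.MathematicalPhysics.QuantumFieldTheory.Balaban1983to89.B4Strip.Sxir; fun_prop
  exact h1.continuousAt.div h2.continuousAt (Sxir_shift_ne_zero hk1 hkN hx)

/-- both cases: `ContinuousAt (uFactorr N k) x` for every alias representative `k < N` and `|x| ≤ π` (`N ≥ 1`). [cite: King1986, (4.3) p.670] -/
theorem continuousAt_uFactorr {N : ℕ} (hN : 1 ≤ N) (k : Fin N) {x : ℝ} (hx : |x| ≤ Real.pi) : ContinuousAt (uFactorr N (k : ℕ)) x := by
  by_cases hk : (k : ℕ) = 0
  · rw [hk]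
    refine continuousAt_uFactorr_zero hN (lt_of_le_of_lt hx ?_)
    have hN1 : (1 : ℝ) ≤ N := by exact_mod_cast hN
    nlinarith [Real.pi_pos]
  · exact continuousAt_uFactorr_shift (Nat.one_le_iff_ne_zero.mpr hk) (by have := k.2; omega) hx

end OneDim

/-! ## §2 All coordinates: the alias weight, the shifted symbol, King's (4.5) -/

section Zone

variable {dd : ℕ}

/-- ★ the alias weight `|u(p′+l)|² = Ur N l p′` is continuous at every point of the closed zone. [cite: King1986, (4.3) p.670] -/
theorem continuousAt_Ur {N : ℕ} (hN : 1 ≤ N) (l : Fin dd → Fin N) {p : Fin dd → ℝ} (hp : ∀ μ, |p μ| ≤ Real.pi) : ContinuousAt (Ur N l) p := by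
  show Tendsto (fun s : Fin dd → ℝ => ∏ μ, uFactorr N (l μ : ℕ) (s μ)) (𝓝 p) (𝓝 (∏ μ, uFactorr N (l μ : ℕ) (p μ)))
  exact tendsto_finsetProd _ fun μ _ => ((continuousAt_uFactorr hN (l μ) (hp μ)).tendsto).comp ((continuous_apply μ).tendsto p)

/-- the shifted fine symbol `Δ^η(p′+l) = DeltaXir N m² (shiftr N l p′)` is continuous in `p′` (everywhere). [cite: King1986, (4.4) p.670] -/
theorem continuous_DeltaXir_shiftr (N : ℕ) (m2 : ℝ) (l : Fin dd → Fin N) : Continuous fun p : Fin dd → ℝ => DeltaXir N m2 (shiftr N l p) := by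
  unfold Literature.MathematicalPhysics.QuantumFieldTheory.Balaban1983to89.B4Strip.DeltaXir Literature.MathematicalPhysics.QuantumFieldTheory.Balaban1983to89.B4Strip.Sxir
    Literature.MathematicalPhysics.QuantumFieldTheory.Balaban1983to89.B4Strip.shiftr
  fun_prop

/-- the shifted fine symbol is positive for `m² > 0`. [cite: King1986, (4.4) p.670] -/
theorem DeltaXir_shiftr_pos (N : ℕ) {m2 : ℝ} (hm : 0 < m2) (l : Fin dd → Fin N) (p : Fin dd → ℝ) : 0 < DeltaXir N m2 (shiftr N l p) := by
  have h0 := DeltaXir_nonneg N 0 le_rfl (shiftr N l p)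
  unfold Literature.MathematicalPhysics.QuantumFieldTheory.Balaban1983to89.B4Strip.DeltaXir at h0 ⊢
  linarith

/-- the composed inverse symbol is positive for `c > 0`, `m² ≥ 0` (every `p′`, the zero mode included). [cite: King1986, (4.5) p.670, (4.12) p.671] -/
theorem composedInvResc_pos_of_pos {c : ℝ} (hc : 0 < c) (N : ℕ) {m2 : ℝ} (hm : 0 ≤ m2) (p : Fin dd → ℝ) : 0 < composedInvResc c N m2 p := by
  unfold composedInvResc
  have hsum : 0 ≤ ∑ m : Fin dd → Fin N, Ur N m p * (DeltaXir N m2 (shiftr N m p))⁻¹ :=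
    Finset.sum_nonneg fun m _ => mul_nonneg (Ur_nonneg N m p) (inv_nonneg.mpr (DeltaXir_nonneg N m2 hm _))
  linarith

/-- ★★ **`p′ ↦ a⁻¹ + Σ_l |u(p′+l)|²Δ^η(p′+l)⁻¹` IS CONTINUOUS ON THE CLOSED ZONE** (`N ≥ 1`, `m² > 0`). [cite: King1986, (4.5) p.670] -/
theorem continuousAt_composedInvResc {N : ℕ} (hN : 1 ≤ N) (c : ℝ) {m2 : ℝ} (hm : 0 < m2) {p : Fin dd → ℝ} (hp : ∀ μ, |p μ| ≤ Real.pi) :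
    ContinuousAt (composedInvResc c N m2) p := by
  show Tendsto (fun s : Fin dd → ℝ => c + ∑ m : Fin dd → Fin N, Ur N m s * (DeltaXir N m2 (shiftr N m s))⁻¹) (𝓝 p)
    (𝓝 (c + ∑ m : Fin dd → Fin N, Ur N m p * (DeltaXir N m2 (shiftr N m p))⁻¹))
  refine tendsto_const_nhds.add (tendsto_finsetSum _ fun m _ => ?_)
  exact ((continuousAt_Ur hN m hp).tendsto).mul
    (((continuous_DeltaXir_shiftr N m2 m).tendsto p).inv₀ (DeltaXir_shiftr_pos N hm m p).ne')

/-- ★★★ **KING's SYMBOL (4.5) IS CONTINUOUS ON THE CLOSED ZONE**: `ContinuousAt (DeltaEff a N m²) p′` at every `p′ ∈ [−π,π]^{d}` (`a > 0`, `m² > 0`, `N ≥ 1`). [cite: King1986, (4.5) p.670] -/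
theorem continuousAt_DeltaEff {N : ℕ} (hN : 1 ≤ N) {a m2 : ℝ} (ha : 0 < a) (hm : 0 < m2) {p : Fin dd → ℝ} (hp : ∀ μ, |p μ| ≤ Real.pi) :
    ContinuousAt (DeltaEff a N m2) p := by
  show ContinuousAt (fun s => (composedInvResc a⁻¹ N m2 s)⁻¹) p
  exact (continuousAt_composedInvResc hN a⁻¹ hm hp).inv₀ (composedInvResc_pos_of_pos (inv_pos.mpr ha) N hm.le p).ne'

/-- ★★ `log Δ^{(k)}` is continuous on the closed zone. [cite: King1986, (4.5) p.670, (3.89) p.668] -/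
theorem continuousAt_log_DeltaEff {N : ℕ} (hN : 1 ≤ N) {a m2 : ℝ} (ha : 0 < a) (hm : 0 < m2) {p : Fin dd → ℝ} (hp : ∀ μ, |p μ| ≤ Real.pi) :
    ContinuousAt (fun s => Real.log (DeltaEff a N m2 s)) p :=
  (continuousAt_DeltaEff hN ha hm hp).log (DeltaEff_pos' ha N hm.le p).ne'

/-- `log Δ^{(k)}` is continuous ON the compact zone `[−π,π]^{d}`. [cite: King1986, (4.5) p.670] -/
theorem continuousOn_log_DeltaEff {N : ℕ} (hN : 1 ≤ N) {a m2 : ℝ} (ha : 0 < a) (hm : 0 < m2) :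
    ContinuousOn (fun s : Fin dd → ℝ => Real.log (DeltaEff a N m2 s)) (Set.Icc (fun _ => -Real.pi) (fun _ => Real.pi)) :=
  fun _ hp => (continuousAt_log_DeltaEff hN ha hm fun μ => abs_le.mpr ⟨hp.1 μ, hp.2 μ⟩).continuousWithinAt

/-- the bounds `0 < Δ^{(k)}(p′) ≤ a` give `log Δ^{(k)}(p′) ≤ log a` everywhere. [cite: King1986, proof of Lemma 4.1 p.671] -/
theorem log_DeltaEff_le {a : ℝ} (ha : 0 < a) (N : ℕ) {m2 : ℝ} (hm : 0 ≤ m2) (p : Fin dd → ℝ) : Real.log (DeltaEff a N m2 p) ≤ Real.log a :=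
  Real.log_le_log (DeltaEff_pos' ha N hm p) (DeltaEff_le ha N hm p)

end Zone

end Summit.QuantumFields.YangMills.BalabanUVNodes.N15KingModelRung.TorusSpectral

end
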